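import Summits.Parity.GeneralizedHardyLittlewood.Theses.RoughSemiprimeRigidity
import Summits.Parity.GeneralizedHardyLittlewood.Theses.TwinMinorArcs
import Summits.Parity.GeneralizedHardyLittlewood.Theorems.LiouvilleShiftedTablesPairsToGHLReduction
import Summits.Parity.GeneralizedHardyLittlewood.Theorems.LiouvilleShiftedTablesPairsHLOdd
import Summits.Parity.GeneralizedHardyLittlewood.Theorems.LiouvilleShiftedTablesPairsToGHLStubToBounded

/-!
# Birth skeleton (BC3) for the crux `WeightedPairsToGHL` (stmt-Parity-14888, route RoughSemiprimeRigidity)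

`WeightedPairsToGHL := WeightedPairs → GeneralizedHardyLittlewood`, where `WeightedPairs` is the
log-weighted Hardy–Littlewood pair asymptotic at every fixed EVEN shift,
`U_h(N) := ∑_{n ≤ N} Λ(n) log n · Λ(n+h) log(n+h) = 𝔖({0,h})·N log²N + o(N log²N)` — verbatim the
twin sum produced by the route's crux-only deciding theorem `closes` (g3 repair 2026-08-16).  It is
the weighted twin of the shared residual `LiouvilleShiftedTables.PairsToGHL` (stmt-Parity-9389).

Kernel facts of the tree that cut the crux (all LANDED, sorry-free, used below BY NAME as glue):

* `Theorems.PairsHL.pairsHL_iff_even` — `PairsHL ↔` its even-shift restriction (odd shifts are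
  settled: `𝔖({0,h}) = 0` and `∑ Λ(n)Λ(n+h) ≪ log³ N`);
* `Theorems.PairsToGHL.SlopedLadder.stub_toBounded` (p140649) — elementary Hardy–Littlewood for
  every fixed POSITIVE one-dimensional system `⇒ TwinMinorArcs.BoundedDickson` (stmt-Parity-13151)
  verbatim (Green–Tao normalisation: signs, translation, intervals, `β_∞`);
* `DicksonFibration.Assembly_holds` — the fibration lemma `DimOne → GeneralizedHardyLittlewood`
  (stmt-Parity-0822, PROVED: `leeYangFibres_fibrationLemma`);
* `Theorems.EngineToGHL.dimOne_of_generalizedHardyLittlewood` — the specialisation `d = 1`.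

Hence the skeleton (three NAMED stubs, composition `WeightedPairsToGHL_of` sorry-free):

1. `stub_unweightPairs` (theorem-grade, M; the ONLY content specific to this crux): the log weights
   come off shift by shift — `U_h(N) = 𝔖N log²N + o(N log²N) ⇒ ∑_{n≤N} Λ(n)Λ(n+h) = 𝔖N + o(N)` for
   even `h` (sandwich over `n ∈ (N^{1-δ}, N]`, where `log n · log(n+h) = (1+O(δ)) log²N`);
2. `stub_pairsClimb` (conjecture-grade; the `k`-tuple / slope content): from Hardy–Littlewood PAIRS
   (`PairsHL`, stmt-Parity-9387 verbatim) to elementary Hardy–Littlewood for EVERY fixed positive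
   non-degenerate one-dimensional system `Φ = (aᵢ n + bᵢ)ᵢ` — the consequent is VERBATIM the output
   of the sibling registered line `Cruxes/PairsToGHL/Lines/sloped_ladder.lean` (its `hall`), whose
   rung/level/atoms stubs are the constructive plan for it (the hypothesis `PairsHL` is its `t = 2`,
   unit-slope instance and is otherwise believed inert: sibling Disproof §8);
3. `stub_shiftLift` (conjecture-grade; the Landau–Siegel axis): `BoundedDickson → DimOne`
   (stmt-Parity-13151 → stmt-Parity-0819, both verbatim) — pointwise Dickson ⇒ shift-uniform Dickson
   (`|bᵢ| ≤ L N`: Goldbach in the shift, pairs uniformly in `h ≤ LN`); IDENTICAL by signature to the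
   sibling's `SlopedLadder.stub_shiftLift` (one residual shared by both cruxes), and the only stub on
   which `Negative.not_generalizedHardyLittlewood_of_unboundedSiegelZeros` bears.

`WeightedPairsToGHL_of : Signature.stub_unweightPairs → Signature.stub_pairsClimb → Signature.stub_shiftLift → WeightedPairsToGHL` threads the crux
hypothesis through all three stubs and the four landed theorems; its hypotheses are the three stub
STATEMENTS under names keyed by the stubs (`def Signature.stub_unweightPairs / Signature.stub_pairsClimb /
Signature.stub_shiftLift : Prop`, last name component = the stub's name, each definitionally the text of the
corresponding `theorem stub_* : <text> := by sorry` — the device of `Cruxes/DialSieveWeights/Lines/birth.lean`,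
so that the native skeleton audit `#h21_check_skeleton` sees declared stubs BY NAME), its conclusion is the route decl
BY NAME, and it is the ONLY theorem of this file concluding the crux (the instantiation
`WeightedPairsToGHL_of stub_unweightPairs stub_pairsClimb stub_shiftLift : WeightedPairsToGHL` and the
plain-arrow full-text form are `example`s).  Sorries live ONLY in the three `stub_*`.  Certificates
(sorry-free) at the end: `weightedPairsToGHL_iff_imp_dimOne` (the crux is EXACTLY `WeightedPairs → DimOne`),
the `example` "given stub 1 alone, the shared crux `PairsToGHL` implies this one", and the `Iff.rfl`
identities of the inlined texts with the named items.
-/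

namespace Summit.Parity.GeneralizedHardyLittlewood.Cruxes.WeightedPairsToGHL.Birth

open Summit.Parity.GeneralizedHardyLittlewood.Theses
open Summit.Parity.GeneralizedHardyLittlewood.Theorems

/-! ### Registered stub signatures (name-keyed for `#h21_check_skeleton`)

Each `def Signature.stub_<name>` below is, definitionally, the statement of the like-named `theorem stub_<name>`
(which repeats the text in full so that `ledger skeleton check` registers the full signature). -/

/-- Statement of `stub_unweightPairs`: the crux hypothesis (log-weighted pairs at every even shift, verbatim)
implies plain Hardy–Littlewood pairs at every even shift (binder order of `Theorems.PairsHL.pairsHL_iff_even`).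
[folklore] -/
def Signature.stub_unweightPairs : Prop :=
  (∀ h : ℕ, 1 ≤ h → Even h → (fun N : ℕ => ∑ n ∈ Finset.Icc 1 N, ArithmeticFunction.vonMangoldt n * Real.log n * (ArithmeticFunction.vonMangoldt (n + h) * Real.log ((n + h : ℕ) : ℝ)) - Literature.NumberTheory.Sieve.singularSeries ({0, (h : ℤ)} : Finset ℤ) * N * Real.log N ^ 2) =o[Filter.atTop] fun N : ℕ => (N : ℝ) * Real.log N ^ 2) →
      ∀ h : ℕ, Even h → 1 ≤ h → (fun N : ℕ => ∑ n ∈ Finset.Icc 1 N, ArithmeticFunction.vonMangoldt n * ArithmeticFunction.vonMangoldt (n + h) - Literature.NumberTheory.Sieve.singularSeries ({0, (h : ℤ)} : Finset ℤ) * N) =o[Filter.atTop] fun N : ℕ => (N : ℝ)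

/-- Statement of `stub_pairsClimb`: `PairsHL` (stmt-Parity-9387 verbatim) implies elementary Hardy–Littlewood
for every fixed positive non-degenerate one-dimensional system (verbatim the sibling ladder output).
[cite: GreenTao2010, Conj. 1.2] -/
def Signature.stub_pairsClimb : Prop :=
  (∀ h : ℕ, 1 ≤ h → (fun N : ℕ => ∑ n ∈ Finset.Icc 1 N, ArithmeticFunction.vonMangoldt n * ArithmeticFunction.vonMangoldt (n + h) - Literature.NumberTheory.Sieve.singularSeries ({0, (h : ℤ)} : Finset ℤ) * N) =o[Filter.atTop] fun N : ℕ => (N : ℝ)) →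
      ∀ t : ℕ, 1 ≤ t → ∀ Φ : Fin t → Literature.NumberTheory.Sieve.AffLinForm 1, Literature.NumberTheory.Sieve.IsNondegenerateSystem Φ → (∀ i, 0 < (Φ i).coeff 0 ∧ 0 ≤ (Φ i).const) → ((fun N : ℕ => ∑ n ∈ Finset.Icc 1 N, ∏ i, Literature.NumberTheory.Sieve.intVonMangoldt ((Φ i).eval ![(n : ℤ)]) - Literature.NumberTheory.Sieve.singularProduct Φ * N) =o[Filter.atTop] fun N : ℕ => (N : ℝ))

/-- Statement of `stub_shiftLift`: `BoundedDickson` (stmt-Parity-13151 verbatim) implies `DimOne`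
(stmt-Parity-0819 verbatim). [cite: GreenTao2010, Conj. 1.2] -/
def Signature.stub_shiftLift : Prop :=
  (∀ (t : ℕ) (Φ : Fin t → Literature.NumberTheory.Sieve.AffLinForm 1), 1 ≤ t → Literature.NumberTheory.Sieve.IsNondegenerateSystem Φ → ∀ ε : ℝ, 0 < ε → ∃ N₀ : ℕ, ∀ N : ℕ, N₀ ≤ N → ∀ K : Set (Fin 1 → ℝ), Convex ℝ K → K ⊆ Literature.NumberTheory.Sieve.realBox 1 N → |Literature.NumberTheory.Sieve.vonMangoldtSum Φ K N - Literature.NumberTheory.Sieve.archFactor Φ K * Literature.NumberTheory.Sieve.singularProduct Φ| ≤ ε * N) →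
      ∀ (t L : ℕ), 1 ≤ t → ∀ ε : ℝ, 0 < ε → ∃ N₀ : ℕ, ∀ N : ℕ, N₀ ≤ N → ∀ Ψ : Fin t → Literature.NumberTheory.Sieve.AffLinForm 1, Literature.NumberTheory.Sieve.IsNondegenerateSystem Ψ → Literature.NumberTheory.Sieve.affLinSize Ψ N ≤ L → ∀ K : Set (Fin 1 → ℝ), Convex ℝ K → K ⊆ Literature.NumberTheory.Sieve.realBox 1 N → |Literature.NumberTheory.Sieve.vonMangoldtSum Ψ K N - Literature.NumberTheory.Sieve.archFactor Ψ K * Literature.NumberTheory.Sieve.singularProduct Ψ| ≤ ε * (N : ℝ)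

/-! ### The three stubs -/

/-- **stub_unweightPairs — removing the log weights, shift by shift (theorem-grade, size M; NEW).**
If for every even `h ≥ 1` the log-weighted pair sum satisfies
`U_h(N) := ∑_{n≤N} Λ(n) log n · Λ(n+h) log(n+h) = 𝔖({0,h}) N log²N + o(N log²N)` (the hypothesis of the
crux, verbatim), then for every even `h ≥ 1` the plain pair sum satisfies
`∑_{n≤N} Λ(n)Λ(n+h) = 𝔖({0,h}) N + o(N)` (the even-shift half of `LiouvilleShiftedTables.PairsHL`, in
the binder order of `Theorems.PairsHL.pairsHL_iff_even`).  Proof plan (sandwich, as in the tree's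
`Theorems.PairsHL.pairsHL_shift_of_count`): put `a_n := Λ(n)Λ(n+h) ≥ 0`, `M := ⌊N^{1-δ}⌋`; on
`M < n ≤ N` one has `(1-δ)² log²N ≤ log n · log(n+h) ≤ (1+δ) log²N` eventually
(`eventually_log_add_le`), so `(U_h(N) - U_h(M))/((1+δ)log²N) ≤ ∑_{M<n≤N} a_n ≤ U_h(N)/((1-δ)² log²N)`,
while `∑_{n≤M} a_n ≤ M log M log(M+h) ≤ N^{1-δ} log²N ≤ δN` (`eventually_rpow_mul_log_sq_le`) and
`U_h(M) ≤ 2𝔖 M log²M` eventually; with `U_h(N) = 𝔖N log²N(1 + o(1))` this pins `∑_{n≤N} a_n` within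
`(𝔖(3δ + δ²)/(1-δ)² + 2δ) N` of `𝔖N` for large `N`, for every `δ ∈ (0, ½)`, i.e. `o(N)`.
(Abel summation against the decreasing weight `1/(log n log(n+h))` is the alternative.)
Sources: HardyLittlewood1923; GreenTao2010 §1; route text of stmt-Parity-14888 ("equivalent to the plain
fixed-shift pairs statement by Abel summation"). -/
theorem stub_unweightPairs :
    (∀ h : ℕ, 1 ≤ h → Even h → (fun N : ℕ => ∑ n ∈ Finset.Icc 1 N, ArithmeticFunction.vonMangoldt n * Real.log n * (ArithmeticFunction.vonMangoldt (n + h) * Real.log ((n + h : ℕ) : ℝ)) - Literature.NumberTheory.Sieve.singularSeries ({0, (h : ℤ)} : Finset ℤ) * N * Real.log N ^ 2) =o[Filter.atTop] fun N : ℕ => (N : ℝ) * Real.log N ^ 2) →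
      ∀ h : ℕ, Even h → 1 ≤ h → (fun N : ℕ => ∑ n ∈ Finset.Icc 1 N, ArithmeticFunction.vonMangoldt n * ArithmeticFunction.vonMangoldt (n + h) - Literature.NumberTheory.Sieve.singularSeries ({0, (h : ℤ)} : Finset ℤ) * N) =o[Filter.atTop] fun N : ℕ => (N : ℝ) := by
  sorry

/-- **stub_pairsClimb — from pairs to every fixed positive one-dimensional system (conjecture-grade;
the `k`-tuple / slope content of the crux).**  Hardy–Littlewood pairs at every fixed shift
(`LiouvilleShiftedTables.PairsHL`, stmt-Parity-9387, inlined verbatim) `→` elementary Hardy–Littlewood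
for every `t ≥ 1` and every non-degenerate system `Φ = (aᵢ n + bᵢ)_{i<t}` with `aᵢ > 0`, `bᵢ ≥ 0`:
`∑_{n≤N} ∏ᵢ Λ(aᵢ n + bᵢ) = 𝔖(Φ) N + o(N)`, `𝔖(Φ) = singularProduct Φ` (Green–Tao) — VERBATIM the
output `hall` of the sibling registered line `Cruxes/PairsToGHL/Lines/sloped_ladder.lean` and the
hypothesis of the LANDED `Theorems.PairsToGHL.SlopedLadder.stub_toBounded`.  Contains the prime
`k`-tuple asymptotics for every admissible fixed tuple and every sloped system (Sophie Germain
`(n, 2n+1)`), i.e. Dickson's conjecture with von Mangoldt weights at BOUNDED shifts; the hypothesis is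
the `t = 2`, `Φ = (n, n+h)` instance of the conclusion (Green–Tao dictionary
`Theorems.PairsToGHL.Negative.vonMangoldtSum_shiftPairSystem`) and no mechanism deriving `k ≥ 3` from
pairs is known (sibling Disproof §8 `toy_pairs_do_not_determine_triples`), so a proof is expected to
prove the consequent outright — the constructive plan is the sibling ladder: base `t = 1` (PNT in
progressions, LANDED `stub_singles` p139370), rung `t → t+1` by Bombieri's asymptotic sieve on one
adjoined form (`stub_rungAtomsPart/LevelPart/MainPart`, `stub_slopedRung`, theorem-grade, OPEN on
stmt-Parity-9389) fed by the conjecture-grade inputs `stub_slopedLevel` (relative EH for the tuple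
weight) and `stub_slopedAtoms` (one Liouville factor).  Why it might fail AS AN HONEST LEMMA: only by the
consequent being false (it is implied by `GeneralizedHardyLittlewood`); Siegel-inert (fixed systems:
MatomakiMerikoski2023 Cor. 1.1).  Sources: HardyLittlewood1923, Dickson1904, GreenTao2010 Conj. 1.2,
BombieriAsymptoticSieve1976, MurtyVatwani2017. -/
theorem stub_pairsClimb :
    (∀ h : ℕ, 1 ≤ h → (fun N : ℕ => ∑ n ∈ Finset.Icc 1 N, ArithmeticFunction.vonMangoldt n * ArithmeticFunction.vonMangoldt (n + h) - Literature.NumberTheory.Sieve.singularSeries ({0, (h : ℤ)} : Finset ℤ) * N) =o[Filter.atTop] fun N : ℕ => (N : ℝ)) →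
      ∀ t : ℕ, 1 ≤ t → ∀ Φ : Fin t → Literature.NumberTheory.Sieve.AffLinForm 1, Literature.NumberTheory.Sieve.IsNondegenerateSystem Φ → (∀ i, 0 < (Φ i).coeff 0 ∧ 0 ≤ (Φ i).const) → ((fun N : ℕ => ∑ n ∈ Finset.Icc 1 N, ∏ i, Literature.NumberTheory.Sieve.intVonMangoldt ((Φ i).eval ![(n : ℤ)]) - Literature.NumberTheory.Sieve.singularProduct Φ * N) =o[Filter.atTop] fun N : ℕ => (N : ℝ)) := by
  sorry

/-- **stub_shiftLift — the shift lift (conjecture-grade; the Landau–Siegel axis of the crux).**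
`BoundedDickson` (stmt-Parity-13151 verbatim: Dickson–Hardy–Littlewood for every FIXED non-degenerate
one-dimensional system over every interval `K ⊆ [-N, N]`) `→ DimOne` (stmt-Parity-0819 verbatim: the
same UNIFORMLY over `‖Φ‖_N ≤ L`, i.e. shifts `|bᵢ| ≤ L·N` — Goldbach `(n, M-n)` for every even `M ≤ LN`,
pairs `(n, n+h)` uniformly in `h ≤ LN`).  IDENTICAL by signature to the sibling residual
`Cruxes.PairsToGHL.SlopedLadder.stub_shiftLift` (one residual for both cruxes; also TwinMinorArcs'
`ResidualLift` (b)).  Landau–Siegel-complete: under `UnboundedSiegelZeros` every fixed system is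
unobstructed (MatomakiMerikoski2023 Cor. 1.1) while the uniform clause fails at `h = 2q`, `N = q^{10}`
(`Theorems.PairsToGHL.Negative.not_generalizedHardyLittlewood_of_unboundedSiegelZeros`), so this stub
carries the whole Siegel certificate of the crux and stubs 1–2 are Siegel-inert; its hypothesis is
implied by its conclusion (`SlopedLadder.boundedDickson_of_dimOne`).  Sources: GreenTao2010 Conj. 1.2,
MatomakiMerikoski2023 Thm 1.3 / Cor. 1.1, GoldstonSuriajaya2021, HardyLittlewood1923. -/
theorem stub_shiftLift :
    (∀ (t : ℕ) (Φ : Fin t → Literature.NumberTheory.Sieve.AffLinForm 1), 1 ≤ t → Literature.NumberTheory.Sieve.IsNondegenerateSystem Φ → ∀ ε : ℝ, 0 < ε → ∃ N₀ : ℕ, ∀ N : ℕ, N₀ ≤ N → ∀ K : Set (Fin 1 → ℝ), Convex ℝ K → K ⊆ Literature.NumberTheory.Sieve.realBox 1 N → |Literature.NumberTheory.Sieve.vonMangoldtSum Φ K N - Literature.NumberTheory.Sieve.archFactor Φ K * Literature.NumberTheory.Sieve.singularProduct Φ| ≤ ε * N) →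
      ∀ (t L : ℕ), 1 ≤ t → ∀ ε : ℝ, 0 < ε → ∃ N₀ : ℕ, ∀ N : ℕ, N₀ ≤ N → ∀ Ψ : Fin t → Literature.NumberTheory.Sieve.AffLinForm 1, Literature.NumberTheory.Sieve.IsNondegenerateSystem Ψ → Literature.NumberTheory.Sieve.affLinSize Ψ N ≤ L → ∀ K : Set (Fin 1 → ℝ), Convex ℝ K → K ⊆ Literature.NumberTheory.Sieve.realBox 1 N → |Literature.NumberTheory.Sieve.vonMangoldtSum Ψ K N - Literature.NumberTheory.Sieve.archFactor Ψ K * Literature.NumberTheory.Sieve.singularProduct Ψ| ≤ ε * (N : ℝ) := by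
  sorry

/-! ### Composition (sorry-free): the crux BY NAME from the three stub statements -/

/-- **Composition — THE skeleton theorem.** `Signature.stub_unweightPairs → Signature.stub_pairsClimb → Signature.stub_shiftLift → WeightedPairsToGHL`:
the crux hypothesis (log-weighted even-shift pairs) is unweighted (stub 1), completed to `PairsHL` by the
settled odd shifts (`Theorems.PairsHL.pairsHL_iff_even`), climbed to every fixed positive system (stub 2),
normalised to `BoundedDickson` (LANDED `Theorems.PairsToGHL.SlopedLadder.stub_toBounded`), lifted to
`DimOne` (stub 3) and fibred to `GeneralizedHardyLittlewood` (PROVED `DicksonFibration.Assembly_holds`).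
Hypotheses = the three registered stub statements by name; conclusion = the route decl by name. [folklore] -/
theorem WeightedPairsToGHL_of :
    Signature.stub_unweightPairs → Signature.stub_pairsClimb → Signature.stub_shiftLift → RoughSemiprimeRigidity.WeightedPairsToGHL := by
  intro h1 h2 h3 hW
  have hP : LiouvilleShiftedTables.PairsHL := PairsHL.pairsHL_iff_even.mpr (h1 hW)
  have hD : DicksonFibration.DimOne := h3 (PairsToGHL.SlopedLadder.stub_toBounded (h2 hP))
  exact DicksonFibration.Assembly_holds hD

/-- Wiring check (an `example`, so that `WeightedPairsToGHL_of` stays the only theorem concluding the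
crux): the three `stub_*` theorems feed the skeleton theorem as stated — this term IS the crux proof once
the three `sorry`s are discharged (today: the crux modulo `sorryAx`, nothing else). -/
example : RoughSemiprimeRigidity.WeightedPairsToGHL :=
  WeightedPairsToGHL_of stub_unweightPairs stub_pairsClimb stub_shiftLift

/-- The plain-arrow FULL-TEXT form `<stub₁ sig> → <stub₂ sig> → <stub₃ sig> → WeightedPairsToGHL` of the
skeleton theorem (same proof term; the registered names unfold definitionally). -/
example :
    ((∀ h : ℕ, 1 ≤ h → Even h → (fun N : ℕ => ∑ n ∈ Finset.Icc 1 N, ArithmeticFunction.vonMangoldt n * Real.log n * (ArithmeticFunction.vonMangoldt (n + h) * Real.log ((n + h : ℕ) : ℝ)) - Literature.NumberTheory.Sieve.singularSeries ({0, (h : ℤ)} : Finset ℤ) * N * Real.log N ^ 2) =o[Filter.atTop] fun N : ℕ => (N : ℝ) * Real.log N ^ 2) →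
      ∀ h : ℕ, Even h → 1 ≤ h → (fun N : ℕ => ∑ n ∈ Finset.Icc 1 N, ArithmeticFunction.vonMangoldt n * ArithmeticFunction.vonMangoldt (n + h) - Literature.NumberTheory.Sieve.singularSeries ({0, (h : ℤ)} : Finset ℤ) * N) =o[Filter.atTop] fun N : ℕ => (N : ℝ)) →
    ((∀ h : ℕ, 1 ≤ h → (fun N : ℕ => ∑ n ∈ Finset.Icc 1 N, ArithmeticFunction.vonMangoldt n * ArithmeticFunction.vonMangoldt (n + h) - Literature.NumberTheory.Sieve.singularSeries ({0, (h : ℤ)} : Finset ℤ) * N) =o[Filter.atTop] fun N : ℕ => (N : ℝ)) →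
      ∀ t : ℕ, 1 ≤ t → ∀ Φ : Fin t → Literature.NumberTheory.Sieve.AffLinForm 1, Literature.NumberTheory.Sieve.IsNondegenerateSystem Φ → (∀ i, 0 < (Φ i).coeff 0 ∧ 0 ≤ (Φ i).const) → ((fun N : ℕ => ∑ n ∈ Finset.Icc 1 N, ∏ i, Literature.NumberTheory.Sieve.intVonMangoldt ((Φ i).eval ![(n : ℤ)]) - Literature.NumberTheory.Sieve.singularProduct Φ * N) =o[Filter.atTop] fun N : ℕ => (N : ℝ))) →
    ((∀ (t : ℕ) (Φ : Fin t → Literature.NumberTheory.Sieve.AffLinForm 1), 1 ≤ t → Literature.NumberTheory.Sieve.IsNondegenerateSystem Φ → ∀ ε : ℝ, 0 < ε → ∃ N₀ : ℕ, ∀ N : ℕ, N₀ ≤ N → ∀ K : Set (Fin 1 → ℝ), Convex ℝ K → K ⊆ Literature.NumberTheory.Sieve.realBox 1 N → |Literature.NumberTheory.Sieve.vonMangoldtSum Φ K N - Literature.NumberTheory.Sieve.archFactor Φ K * Literature.NumberTheory.Sieve.singularProduct Φ| ≤ ε * N) →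
      ∀ (t L : ℕ), 1 ≤ t → ∀ ε : ℝ, 0 < ε → ∃ N₀ : ℕ, ∀ N : ℕ, N₀ ≤ N → ∀ Ψ : Fin t → Literature.NumberTheory.Sieve.AffLinForm 1, Literature.NumberTheory.Sieve.IsNondegenerateSystem Ψ → Literature.NumberTheory.Sieve.affLinSize Ψ N ≤ L → ∀ K : Set (Fin 1 → ℝ), Convex ℝ K → K ⊆ Literature.NumberTheory.Sieve.realBox 1 N → |Literature.NumberTheory.Sieve.vonMangoldtSum Ψ K N - Literature.NumberTheory.Sieve.archFactor Ψ K * Literature.NumberTheory.Sieve.singularProduct Ψ| ≤ ε * (N : ℝ)) →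
    RoughSemiprimeRigidity.WeightedPairsToGHL :=
  WeightedPairsToGHL_of

/-! ### Certificates (sorry-free) -/

/-- **The crux is EXACTLY `WeightedPairs → DimOne`**, unconditionally: forward by the specialisation
`d = 1` (`Theorems.EngineToGHL.dimOne_of_generalizedHardyLittlewood`), backward by the PROVED
fibration lemma `DicksonFibration.Assembly_holds`. [folklore] -/
theorem weightedPairsToGHL_iff_imp_dimOne :
    RoughSemiprimeRigidity.WeightedPairsToGHL ↔
      ((∀ h : ℕ, 1 ≤ h → Even h → (fun N : ℕ => ∑ n ∈ Finset.Icc 1 N, ArithmeticFunction.vonMangoldt n * Real.log n * (ArithmeticFunction.vonMangoldt (n + h) * Real.log ((n + h : ℕ) : ℝ)) - Literature.NumberTheory.Sieve.singularSeries ({0, (h : ℤ)} : Finset ℤ) * N * Real.log N ^ 2) =o[Filter.atTop] fun N : ℕ => (N : ℝ) * Real.log N ^ 2) →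
        DicksonFibration.DimOne) :=
  ⟨fun hX hW => EngineToGHL.dimOne_of_generalizedHardyLittlewood (hX hW),
    fun h hW => DicksonFibration.Assembly_holds (h hW)⟩

/-- **Given stub 1 alone, the shared crux `PairsToGHL` (stmt-Parity-9389) implies this crux**: the
weighted twin is no harder than the plain one once the weights come off (an `example`, so that the
skeleton theorem stays the unique crux-concluding theorem of this file). [folklore] -/
example (h1 : Signature.stub_unweightPairs) (hX : LiouvilleShiftedTables.PairsToGHL) :
    RoughSemiprimeRigidity.WeightedPairsToGHL :=
  fun hW => hX (PairsHL.pairsHL_iff_even.mpr (h1 hW))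

/-- Conversely the crux gives back `PairsToGHL` as soon as plain even-shift pairs re-acquire the log weights
(the reverse sandwich, not stubbed here): recorded as the implication it reduces to. [folklore] -/
example (hX : RoughSemiprimeRigidity.WeightedPairsToGHL)
    (hRe : LiouvilleShiftedTables.PairsHL → ∀ h : ℕ, 1 ≤ h → Even h → (fun N : ℕ => ∑ n ∈ Finset.Icc 1 N, ArithmeticFunction.vonMangoldt n * Real.log n * (ArithmeticFunction.vonMangoldt (n + h) * Real.log ((n + h : ℕ) : ℝ)) - Literature.NumberTheory.Sieve.singularSeries ({0, (h : ℤ)} : Finset ℤ) * N * Real.log N ^ 2) =o[Filter.atTop] fun N : ℕ => (N : ℝ) * Real.log N ^ 2) :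
    LiouvilleShiftedTables.PairsToGHL :=
  fun hP => hX (hRe hP)

/-- `Signature.stub_unweightPairs` IS the statement of `stub_unweightPairs` (and likewise for the other two).
[folklore] -/
example : Signature.stub_unweightPairs ↔
    (((∀ h : ℕ, 1 ≤ h → Even h → (fun N : ℕ => ∑ n ∈ Finset.Icc 1 N, ArithmeticFunction.vonMangoldt n * Real.log n * (ArithmeticFunction.vonMangoldt (n + h) * Real.log ((n + h : ℕ) : ℝ)) - Literature.NumberTheory.Sieve.singularSeries ({0, (h : ℤ)} : Finset ℤ) * N * Real.log N ^ 2) =o[Filter.atTop] fun N : ℕ => (N : ℝ) * Real.log N ^ 2) →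
      ∀ h : ℕ, Even h → 1 ≤ h → (fun N : ℕ => ∑ n ∈ Finset.Icc 1 N, ArithmeticFunction.vonMangoldt n * ArithmeticFunction.vonMangoldt (n + h) - Literature.NumberTheory.Sieve.singularSeries ({0, (h : ℤ)} : Finset ℤ) * N) =o[Filter.atTop] fun N : ℕ => (N : ℝ))) :=
  Iff.rfl

/-- The hypothesis of `stub_pairsClimb` IS the shared item `LiouvilleShiftedTables.PairsHL`
(stmt-Parity-9387). [folklore] -/
theorem pairsClimb_hyp_iff :
    (∀ h : ℕ, 1 ≤ h → (fun N : ℕ => ∑ n ∈ Finset.Icc 1 N, ArithmeticFunction.vonMangoldt n * ArithmeticFunction.vonMangoldt (n + h) - Literature.NumberTheory.Sieve.singularSeries ({0, (h : ℤ)} : Finset ℤ) * N) =o[Filter.atTop] fun N : ℕ => (N : ℝ)) ↔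
      LiouvilleShiftedTables.PairsHL :=
  Iff.rfl

/-- The registered statement `Signature.stub_shiftLift` IS `TwinMinorArcs.BoundedDickson → DicksonFibration.DimOne`
(stmt-Parity-13151 → stmt-Parity-0819). [folklore] -/
theorem shiftLift_iff_named : Signature.stub_shiftLift ↔ (TwinMinorArcs.BoundedDickson → DicksonFibration.DimOne) :=
  Iff.rfl

/-- `Signature.stub_pairsClimb`'s hypothesis IS `LiouvilleShiftedTables.PairsHL` and its output feeds the LANDED
`stub_toBounded` into `TwinMinorArcs.BoundedDickson` (stmt-Parity-13151) by name (an `example`: this file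
claims no item of another route). [folklore] -/
example (h2 : Signature.stub_pairsClimb) (hP : LiouvilleShiftedTables.PairsHL) : TwinMinorArcs.BoundedDickson :=
  PairsToGHL.SlopedLadder.stub_toBounded (h2 hP)

/-- The hypothesis of `stub_shiftLift` IS `TwinMinorArcs.BoundedDickson` (stmt-Parity-13151) and its
conclusion IS `DicksonFibration.DimOne` (stmt-Parity-0819) — full-text form. [folklore] -/
theorem shiftLift_iff :
    ((∀ (t : ℕ) (Φ : Fin t → Literature.NumberTheory.Sieve.AffLinForm 1), 1 ≤ t → Literature.NumberTheory.Sieve.IsNondegenerateSystem Φ → ∀ ε : ℝ, 0 < ε → ∃ N₀ : ℕ, ∀ N : ℕ, N₀ ≤ N → ∀ K : Set (Fin 1 → ℝ), Convex ℝ K → K ⊆ Literature.NumberTheory.Sieve.realBox 1 N → |Literature.NumberTheory.Sieve.vonMangoldtSum Φ K N - Literature.NumberTheory.Sieve.archFactor Φ K * Literature.NumberTheory.Sieve.singularProduct Φ| ≤ ε * N) →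
      ∀ (t L : ℕ), 1 ≤ t → ∀ ε : ℝ, 0 < ε → ∃ N₀ : ℕ, ∀ N : ℕ, N₀ ≤ N → ∀ Ψ : Fin t → Literature.NumberTheory.Sieve.AffLinForm 1, Literature.NumberTheory.Sieve.IsNondegenerateSystem Ψ → Literature.NumberTheory.Sieve.affLinSize Ψ N ≤ L → ∀ K : Set (Fin 1 → ℝ), Convex ℝ K → K ⊆ Literature.NumberTheory.Sieve.realBox 1 N → |Literature.NumberTheory.Sieve.vonMangoldtSum Ψ K N - Literature.NumberTheory.Sieve.archFactor Ψ K * Literature.NumberTheory.Sieve.singularProduct Ψ| ≤ ε * (N : ℝ)) ↔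
      (TwinMinorArcs.BoundedDickson → DicksonFibration.DimOne) :=
  Iff.rfl

end Summit.Parity.GeneralizedHardyLittlewood.Cruxes.WeightedPairsToGHL.Birth
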